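import Literature.NumberTheory.EllipticCurves.HeegnerGeomCoherentDataProofs
import Literature.NumberTheory.EllipticCurves.HeegnerGeomBottomRelationProofs
import HarnessLib

/-!
# Pinning the CGLS shift: `d(k) + δ = k + 1` above the torsion depth, from the two halves of the
# classical structure of the anticyclotomic tower inside the ring class tower — THEOREMS ONLY

Topic `NumberTheory/EllipticCurves`; namespace `Literature.NumberTheory.EllipticCurves`. No definition, no
named fact. Cell `pub/bsd-print-x9`, LEAD `bsd-line-x9-p1` (envelope infrastructure, part VI-a).

For a `d(k)`-shifted datum `C : CastellaGrossiLeeSkinner2022.StabilizedHeegnerData` (CGLS 2022, Thm. 4.1.1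
proof: "`d(k) = min{d ∈ ℤ_{≥0} : K_k ⊂ K[p^d]}`", torsion depth `δ` with `K_∞ ∩ K[1] = K_δ`) the kernel a priori
knows only what the structure's fields say. This file derives the printed values
**`d(k) = k − δ + 1` for `k > δ`** (CGLS Rem. 4.1.4; `d(k) = k + 1` when `p ∤ h_K`, Howard 2004 §3.3 "`K_k` is the
maximal `p`-power subextension of `K[p^{k+1}]`", Perrin-Riou 1987 §1) from:
* `K_k ⊆ K[p^{k+1}]` for all `k` (`hTw1`) and `[K[p] : K[1]] = p − 1` (`hcardp`: `p` split, `𝒪_K^× = {±1}`) —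
  these give the LOWER bound `d(k) + δ ≥ k + 1` (`succ_le_d_add_depth`) by stepping DOWN the towers
  (`ringClassSubgroup_le_layerSubgroup_of_succ`: `g^p ∈ Gal(K̄/K[p^{d+1}])` for `g ∈ Gal(K̄/K[p^d])`, `d ≥ 1`,
  Cox Cor. 7.28), and `2 ≤ d(k) ≤ k + 1`;
* `K[p^∞] ⊆ K_∞ · K[p]`, i.e. `Gal(K̄/K_∞) ⊓ Gal(K̄/K[p]) ≤ Gal(K̄/K[p^d])` for all `d` (`hTw2`; classically
  `Gal(K[p^∞]/K[p]) ≅ (1 + p𝒪_{K,p})/(1 + pℤ_p) ≅ ℤ_p` for odd `p`, Cox Thm. 7.24) — this gives the STEP property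
  `Gal(K̄/K[p^j]) ≤ Gal(K̄/K_a) ⇒ Gal(K̄/K[p^{j+1}]) ≤ Gal(K̄/K_{a+1})` (`j ≥ 1`;
  `ringClassSubgroup_succ_le_layerSubgroup_succ_of_ker_inf_le`, through "finite-index subgroups of `ℤ_p` are
  `p^bℤ_p`", `PadicInt.ofAdd_mul_mem_of_finiteIndex`) and hence the UPPER bound (`d_add_depth_le_succ`).
Consequences: `d_add_depth_eq`, `d_succ_eq` (`d(k+1) = d(k) + 1`, `k > δ`), `d_depth_succ` (`d(δ+1) = 2`). The
lower bound alone (no `hTw2`) is what the GENERALISED point identities of `HeegnerGeomLayerDescentProofs` use;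
the pin is what turns them into the printed ones (`v_j = u_{j−1}`, …; `HeegnerGeomCoherentPointIdentitiesProofs`).

## References

* [CastellaGrossiLeeSkinner2022] F. Castella, G. Grossi, J. Lee, C. Skinner, *On the anticyclotomic Iwasawa
  theory of rational elliptic curves at Eisenstein primes*, Invent. Math. 227 (2022), Thm. 4.1.1 (proof:
  `d(k)`, `P_k[n]`) and Rem. 4.1.4 (arXiv:2008.02571v2, p. 22).
* [Howard2004HeegnerKolyvagin] B. Howard, *The Heegner point Kolyvagin system*, Compos. Math. 140 (2004), §3.3.
* [PerrinRiou1987BSMF] B. Perrin-Riou, *Fonctions L p-adiques, théorie d'Iwasawa et points de Heegner*,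
  Bull. SMF 115 (1987), §1 (the tower `K_∞ ⊂ ∪ K[p^n]`), §3.3 (relations de distribution).
* [Cox2013] D. A. Cox, *Primes of the form x² + ny²*, 2nd ed. (2013), Thm. 7.24, Cor. 7.28.
-/

set_option autoImplicit false

noncomputable section

open scoped Classical

namespace Literature.NumberTheory.EllipticCurves

open WeierstrassCurve RingClassField ModularForms

variable {K : Type} [Field K] [NumberField K] {p : ℕ} [Fact p.Prime]

/-! ### §1 Pinning the shift: `d(k) + δ = k + 1` above the torsion depth -/

/-- **One step DOWN the two towers** (`d ≥ 1`): `K_{k+1} ⊆ K[p^{d+1}] ⇒ K_k ⊆ K[p^d]`. For `g ∈ Gal(K̄/K[p^d])`,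
`g^p ∈ Gal(K̄/K[p^{d+1}])` (`[K[p^{d+1}] : K[p^d]] = p`, Cox Cor. 7.28, and normality), so `p · κ(g) ∈ p^{k+1}ℤ_p`
and `κ(g) ∈ p^kℤ_p`. [cite: Cox2013, §7.D Cor. 7.28] [cite: PerrinRiou1987BSMF, §1 (K_∞ inside ∪ K[p^n])] -/
theorem ringClassSubgroup_le_layerSubgroup_of_succ (hK : IsImaginaryQuadratic K) (κ : ZpExtension K p)
    (jbar : AlgebraicClosure K →+* ℂ) {d k : ℕ} (hd : 1 ≤ d)
    (h : ringClassSubgroup K (p ^ (d + 1)) jbar ≤ κ.layerSubgroup (k + 1)) :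
    ringClassSubgroup K (p ^ d) jbar ≤ κ.layerSubgroup k := by
  have hp : p.Prime := Fact.out
  intro g hg
  haveI : (ringClassSubgroup K (p ^ (d + 1)) jbar).Normal :=
    ringClassSubgroup_normal hK jbar (pow_ne_zero _ hp.ne_zero)
  have hrel : (ringClassSubgroup K (p ^ (d + 1)) jbar).relIndex (ringClassSubgroup K (p ^ d) jbar) = p := by
    have := relIndex_ringClassSubgroup_eq_prime hK jbar hp (dvd_pow_self p (by omega))
      (pow_ne_zero d hp.ne_zero)
    rwa [← pow_succ'] at this
  have hgp : g ^ p ∈ ringClassSubgroup K (p ^ (d + 1)) jbar := by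
    have := Subgroup.pow_relIndex_mem (ringClassSubgroup K (p ^ (d + 1)) jbar) hg
    rwa [hrel] at this
  have hmem := h hgp
  rw [ZpExtension.mem_layerSubgroup, map_pow, toAdd_pow, nsmul_eq_mul, pow_succ'] at hmem
  rw [ZpExtension.mem_layerSubgroup]
  have hp0 : (p : ℤ_[p]) ≠ 0 := by exact_mod_cast hp.ne_zero
  exact (mul_dvd_mul_iff_left hp0).mp hmem

/-- **Finite-index subgroups of `ℤ_p` are the `p^bℤ_p`** in the form used below: if a subgroup `S` of
(multiplicative) `ℤ_p` has finite index and contains an element `p^a · w` with `w` a unit, then `S ⊇ p^aℤ_p`.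
[folklore] -/
private theorem PadicInt.ofAdd_mul_mem_of_finiteIndex {S : Subgroup (Multiplicative ℤ_[p])} (hS : S.index ≠ 0)
    {a : ℕ} {w : ℤ_[p]} (hw : IsUnit w) (hmem : Multiplicative.ofAdd ((p : ℤ_[p]) ^ a * w) ∈ S)
    (y : ℤ_[p]) : Multiplicative.ofAdd ((p : ℤ_[p]) ^ a * y) ∈ S := by
  have hp : p.Prime := Fact.out
  -- `S ⊇ nℤ_p = p^cℤ_p`, `n = p^c u` the index
  obtain ⟨c, u, hu, hn⟩ := Nat.exists_eq_pow_mul_and_not_dvd hS p hp.ne_one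
  have hpow : ∀ z : ℤ_[p], Multiplicative.ofAdd ((S.index : ℤ_[p]) * z) ∈ S := fun z ↦ by
    have := S.pow_index_mem (Multiplicative.ofAdd z)
    rwa [← ofAdd_nsmul, nsmul_eq_mul] at this
  have huunit : IsUnit (u : ℤ_[p]) := by
    rw [PadicInt.isUnit_iff]
    by_contra hne
    have hlt : ‖((u : ℤ) : ℤ_[p])‖ < 1 := by
      rw [Int.cast_natCast]; exact lt_of_le_of_ne (PadicInt.norm_le_one _) hne
    rw [PadicInt.norm_int_lt_one_iff_dvd] at hlt
    exact hu (Int.natCast_dvd_natCast.mp hlt)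
  obtain ⟨v, hv⟩ := huunit.exists_right_inv
  have hpc : ∀ z : ℤ_[p], Multiplicative.ofAdd ((p : ℤ_[p]) ^ c * z) ∈ S := fun z ↦ by
    have h1 := hpow (v * z)
    rwa [hn, Nat.cast_mul, Nat.cast_pow, mul_assoc, ← mul_assoc (u : ℤ_[p]), hv, one_mul] at h1
  rcases le_or_gt c a with hca | hac
  · -- `p^a y = p^c (p^{a-c} y)`
    have := hpc ((p : ℤ_[p]) ^ (a - c) * y)
    rwa [← mul_assoc, ← pow_add, Nat.add_sub_cancel' hca] at this
  · -- `p^a y = n₀ • (p^a w) + p^c (w r)`, `w⁻¹ y = n₀ + p^{c-a} r`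
    obtain ⟨wi, hwi⟩ := hw.exists_right_inv
    set t : ℤ_[p] := wi * y with ht
    have happr := PadicInt.appr_spec (c - a) t
    rw [Ideal.mem_span_singleton] at happr
    obtain ⟨r, hr⟩ := happr
    set n0 : ℕ := t.appr (c - a) with hn0
    have hy' : y = w * t := by rw [ht, ← mul_assoc, hwi, one_mul]
    have hpc' : (p : ℤ_[p]) ^ c = (p : ℤ_[p]) ^ a * (p : ℤ_[p]) ^ (c - a) := by
      rw [← pow_add, Nat.add_sub_cancel' hac.le]
    have ht' : t = (n0 : ℤ_[p]) + (p : ℤ_[p]) ^ (c - a) * r := by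
      rw [← hr]; ring
    have hy : (p : ℤ_[p]) ^ a * y = (n0 : ℤ_[p]) * ((p : ℤ_[p]) ^ a * w) + (p : ℤ_[p]) ^ c * (w * r) := by
      rw [hy', hpc', ht']
      ring
    rw [hy, ofAdd_add, ← nsmul_eq_mul, ofAdd_nsmul]
    exact S.mul_mem (S.pow_mem hmem _) (hpc _)

/-- **One step UP the two towers** (`j ≥ 1`), from `K[p^∞] ⊆ K_∞ · K[p]` (hypothesis `hTw2`:
`Gal(K̄/K_∞) ⊓ Gal(K̄/K[p]) ≤ Gal(K̄/K[p^d])` for all `d`): `K_a ⊇? no — if `Gal(K̄/K[p^j]) ≤ Gal(K̄/K_a)` then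
`Gal(K̄/K[p^{j+1}]) ≤ Gal(K̄/K_{a+1})`, i.e. `K_∞ ∩ K[p^{j+1}] ⊋ K_∞ ∩ K[p^j]` climbs one layer. Otherwise some
`h₀ ∈ Gal(K̄/K[p^{j+1}])` has `κ(h₀) = p^a·(unit)`, the image `κ(Gal(K̄/K[p^{j+1}]))` (finite index in `ℤ_p`)
is all of `p^aℤ_p ⊇ κ(Gal(K̄/K[p^j]))`, so `Gal(K̄/K[p^j]) ⊆ Gal(K̄/K[p^{j+1}])·(Gal(K̄/K_∞) ⊓ Gal(K̄/K[p])) =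
Gal(K̄/K[p^{j+1}])`, contradicting `[K[p^{j+1}] : K[p^j]] = p`. (Classically: `Gal(K[p^∞]/K[p]) ≅
(1 + p𝒪_{K,p})/(1 + pℤ_p) ≅ ℤ_p` for odd `p`, Cox Thm. 7.24.) [cite: Cox2013, Thm. 7.24 and Cor. 7.28]
[cite: PerrinRiou1987BSMF, §1 (K_∞ inside ∪ K[p^n])] -/
theorem ringClassSubgroup_succ_le_layerSubgroup_succ_of_ker_inf_le (hK : IsImaginaryQuadratic K)
    (κ : ZpExtension K p) (jbar : AlgebraicClosure K →+* ℂ)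
    (hTw2 : ∀ d : ℕ, κ.kerSubgroup ⊓ ringClassSubgroup K p jbar ≤ ringClassSubgroup K (p ^ d) jbar)
    {j a : ℕ} (hj : 1 ≤ j) (h : ringClassSubgroup K (p ^ j) jbar ≤ κ.layerSubgroup a) :
    ringClassSubgroup K (p ^ (j + 1)) jbar ≤ κ.layerSubgroup (a + 1) := by
  have hp : p.Prime := Fact.out
  by_contra hnot
  obtain ⟨h₀, hh₀, hnot₀⟩ := SetLike.not_le_iff_exists.mp hnot
  have hanti : ringClassSubgroup K (p ^ (j + 1)) jbar ≤ ringClassSubgroup K (p ^ j) jbar :=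
    ringClassSubgroup_anti hK jbar (pow_dvd_pow p (Nat.le_succ j)) (pow_ne_zero _ hp.ne_zero)
  have hjp : ringClassSubgroup K (p ^ j) jbar ≤ ringClassSubgroup K p jbar := by
    have := ringClassSubgroup_anti hK jbar (dvd_pow_self p (by omega : j ≠ 0)) (pow_ne_zero j hp.ne_zero)
    simpa using this
  -- `κ(h₀) = p^a · w`, `w` a unit
  have ha : h₀ ∈ κ.layerSubgroup a := h (hanti hh₀)
  rw [ZpExtension.mem_layerSubgroup] at ha
  obtain ⟨w, hw⟩ := ha
  have hwunit : IsUnit w := by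
    by_contra hwn
    apply hnot₀
    rw [ZpExtension.mem_layerSubgroup, hw, pow_succ]
    exact mul_dvd_mul_left _ ((PadicInt.norm_lt_one_iff_dvd w).mp (PadicInt.not_isUnit_iff.mp hwn))
  -- the image of `Gal(K̄/K[p^{j+1}])` in `ℤ_p` has finite index and contains `p^a w`, hence `p^aℤ_p`
  set S : Subgroup (Multiplicative ℤ_[p]) :=
    (ringClassSubgroup K (p ^ (j + 1)) jbar).map κ.toContinuousMonoidHom.toMonoidHom with hSdef
  have hSidx : S.index ≠ 0 := by
    haveI := finiteIndex_ringClassSubgroup K (p ^ (j + 1)) jbar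
    intro h0
    have hdvd := (ringClassSubgroup K (p ^ (j + 1)) jbar).index_map_dvd
      (f := κ.toContinuousMonoidHom.toMonoidHom) κ.surjective
    rw [← hSdef, h0, zero_dvd_iff] at hdvd
    exact Subgroup.FiniteIndex.index_ne_zero hdvd
  have hmemS : Multiplicative.ofAdd ((p : ℤ_[p]) ^ a * w) ∈ S := by
    refine Subgroup.mem_map.mpr ⟨h₀, hh₀, ?_⟩
    rw [← hw, ofAdd_toAdd]
    rfl
  have hall : ∀ y : ℤ_[p], ∃ g ∈ ringClassSubgroup K (p ^ (j + 1)) jbar,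
      (κ g).toAdd = (p : ℤ_[p]) ^ a * y := fun y ↦ by
    obtain ⟨g, hg, hκ⟩ :=
      Subgroup.mem_map.mp (PadicInt.ofAdd_mul_mem_of_finiteIndex hSidx hwunit hmemS y)
    refine ⟨g, hg, ?_⟩
    change κ g = Multiplicative.ofAdd _ at hκ
    rw [hκ, toAdd_ofAdd]
  -- hence `Gal(K̄/K[p^j]) ≤ Gal(K̄/K[p^{j+1}])`
  have hle : ringClassSubgroup K (p ^ j) jbar ≤ ringClassSubgroup K (p ^ (j + 1)) jbar := by
    intro g hg
    have hga : g ∈ κ.layerSubgroup a := h hg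
    rw [ZpExtension.mem_layerSubgroup] at hga
    obtain ⟨y, hy⟩ := hga
    obtain ⟨g₁, hg₁, hκ₁⟩ := hall y
    have hker : g₁⁻¹ * g ∈ κ.kerSubgroup := by
      have heq : κ g₁ = κ g := Multiplicative.toAdd.injective (by rw [hκ₁, hy])
      rw [ZpExtension.mem_kerSubgroup, map_mul, map_inv, heq, inv_mul_cancel]
    have hGp : g₁⁻¹ * g ∈ ringClassSubgroup K p jbar :=
      (ringClassSubgroup K p jbar).mul_mem ((ringClassSubgroup K p jbar).inv_mem (hjp (hanti hg₁))) (hjp hg)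
    have hmem := hTw2 (j + 1) (Subgroup.mem_inf.mpr ⟨hker, hGp⟩)
    rw [← mul_inv_cancel_left g₁ g]
    exact (ringClassSubgroup K (p ^ (j + 1)) jbar).mul_mem hg₁ hmem
  -- contradiction with `[K[p^{j+1}] : K[p^j]] = p`
  have hrel : (ringClassSubgroup K (p ^ (j + 1)) jbar).relIndex (ringClassSubgroup K (p ^ j) jbar) = p := by
    have := relIndex_ringClassSubgroup_eq_prime hK jbar hp (dvd_pow_self p (by omega : j ≠ 0))
      (pow_ne_zero j hp.ne_zero)
    rwa [← pow_succ'] at this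
  rw [Subgroup.relIndex_eq_one.mpr hle] at hrel
  exact hp.one_lt.ne hrel

/-- **The step property of the two towers** (the form consumers carry): for every `j ≥ 1` and `a`,
`Gal(K̄/K[p^j]) ≤ Gal(K̄/K_a) → Gal(K̄/K[p^{j+1}]) ≤ Gal(K̄/K_{a+1})` — from `K[p^∞] ⊆ K_∞ · K[p]`.
[cite: Cox2013, Thm. 7.24] [cite: PerrinRiou1987BSMF, §1] -/
theorem ringClassTower_step_of_ker_inf_le (hK : IsImaginaryQuadratic K) (κ : ZpExtension K p)
    (jbar : AlgebraicClosure K →+* ℂ)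
    (hTw2 : ∀ d : ℕ, κ.kerSubgroup ⊓ ringClassSubgroup K p jbar ≤ ringClassSubgroup K (p ^ d) jbar) :
    ∀ j a : ℕ, 1 ≤ j → ringClassSubgroup K (p ^ j) jbar ≤ κ.layerSubgroup a →
      ringClassSubgroup K (p ^ (j + 1)) jbar ≤ κ.layerSubgroup (a + 1) :=
  fun _ _ hj h ↦ ringClassSubgroup_succ_le_layerSubgroup_succ_of_ker_inf_le hK κ jbar hTw2 hj h

namespace CastellaGrossiLeeSkinner2022.StabilizedHeegnerData

variable {N : ℕ} [NeZero N] {W : WeierstrassCurve ℚ} {κ : ZpExtension K p} {jbar : AlgebraicClosure K →+* ℂ}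
  (C : CastellaGrossiLeeSkinner2022.StabilizedHeegnerData N W K κ jbar)

/-- `d(k) ≤ k + 1` for every `k`, from `K_k ⊆ K[p^{k+1}]` (minimality of `d(k)`).
[cite: CastellaGrossiLeeSkinner2022, Thm. 4.1.1 proof (d(k))] [cite: PerrinRiou1987BSMF, §1] -/
theorem d_le_succ (hTw1 : ∀ k, ringClassSubgroup K (p ^ (k + 1)) jbar ≤ κ.layerSubgroup k) (k : ℕ) :
    C.d k ≤ k + 1 := by
  by_contra h
  exact C.d_min k (k + 1) (not_le.mp h) (hTw1 k)

/-- **`d(k) ≥ 2` above the torsion depth** (`p` with `[K[p] : K[1]] = p − 1`: `K_k ⊆ K[p]` would force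
`K_k ⊆ K[1]`). [cite: CastellaGrossiLeeSkinner2022, Thm. 4.1.1 proof (d(k)) and Rem. 4.1.4 (k ≥ 1 branch)] -/
theorem two_le_d (hK : IsImaginaryQuadratic K)
    (hcardp : Nat.card (ringClassGalOver (jbar.comp (algebraMap K (AlgebraicClosure K))) p 1) = p - 1)
    {k : ℕ} (hk : C.depth < k) : 2 ≤ C.d k := by
  have hp : p.Prime := Fact.out
  have h1 : 1 ≤ C.d k := C.d_pos_of_depth_lt hk
  by_contra hlt
  have hd1 : C.d k = 1 := by omega
  have hle : ringClassSubgroup K p jbar ≤ κ.layerSubgroup k := by simpa [hd1] using C.layer_le k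
  have h1le : ringClassSubgroup K 1 jbar ≤ κ.layerSubgroup k :=
    ringClassSubgroup_one_le_of_ringClassSubgroup_prime_le hK jbar hp hcardp (κ.index_layerSubgroup k) hle
  have h0 : C.d k = 0 := by
    by_contra hne
    exact C.d_min k 0 (by omega) (by simpa using h1le)
  omega

/-- **Lower bound `d(k) + δ ≥ k + 1` for `k > δ`** — from `K_k ⊆ K[p^{k+1}]` and `[K[p] : K[1]] = p − 1` alone:
step down `d(k) − 1` times from `K_k ⊆ K[p^{d(k)}]` to `K_{k+1−d(k)} ⊆ K[p] ⇒ ⊆ K[1]`, i.e. `k + 1 − d(k) ≤ δ`.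
[cite: CastellaGrossiLeeSkinner2022, Thm. 4.1.1 proof (d(k) = min {d : K_k ⊂ K[p^d]})] [cite: PerrinRiou1987BSMF, §1] -/
theorem succ_le_d_add_depth (hK : IsImaginaryQuadratic K)
    (hTw1 : ∀ k, ringClassSubgroup K (p ^ (k + 1)) jbar ≤ κ.layerSubgroup k)
    (hcardp : Nat.card (ringClassGalOver (jbar.comp (algebraMap K (AlgebraicClosure K))) p 1) = p - 1)
    {k : ℕ} (hk : C.depth < k) : k + 1 ≤ C.d k + C.depth := by
  have hp : p.Prime := Fact.out
  have hdle : C.d k ≤ k + 1 := C.d_le_succ hTw1 k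
  have hd1 : 1 ≤ C.d k := C.d_pos_of_depth_lt hk
  -- step down: `Gal(K̄/K[p^{d(k) - i}]) ≤ Gal(K̄/K_{k - i})` for `i ≤ d(k) - 1`
  have hdown : ∀ i, i ≤ C.d k - 1 → ringClassSubgroup K (p ^ (C.d k - i)) jbar ≤ κ.layerSubgroup (k - i) := by
    intro i
    induction i with
    | zero => intro _; simpa using C.layer_le k
    | succ i ih =>
      intro hi
      have h' := ih (by omega)
      have heq1 : C.d k - i = (C.d k - (i + 1)) + 1 := by omega
      have heq2 : k - i = (k - (i + 1)) + 1 := by omega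
      rw [heq1, heq2] at h'
      exact ringClassSubgroup_le_layerSubgroup_of_succ hK κ jbar (by omega) h'
  have hp1 : ringClassSubgroup K p jbar ≤ κ.layerSubgroup (k + 1 - C.d k) := by
    have := hdown (C.d k - 1) le_rfl
    have heq1 : C.d k - (C.d k - 1) = 1 := by omega
    have heq2 : k - (C.d k - 1) = k + 1 - C.d k := by omega
    rw [heq1, heq2, pow_one] at this
    exact this
  have h1le : ringClassSubgroup K 1 jbar ≤ κ.layerSubgroup (k + 1 - C.d k) :=
    ringClassSubgroup_one_le_of_ringClassSubgroup_prime_le hK jbar hp hcardp (κ.index_layerSubgroup _) hp1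
  have h0 : C.d (k + 1 - C.d k) = 0 := by
    by_contra hne
    exact C.d_min (k + 1 - C.d k) 0 (by omega) (by simpa using h1le)
  have := (C.d_eq_zero_iff _).mp h0
  omega

/-- **Upper bound `d(k) + δ ≤ k + 1` for `k > δ`** — needs the step property (`K[p^∞] ⊆ K_∞K[p]`): climb from
`K_δ ⊆ K[1] ⊆ K[p]` to `K_{δ+j−1} ⊆ K[p^j]`, so `K_k ⊆ K[p^{k+1−δ}]`.
[cite: CastellaGrossiLeeSkinner2022, Thm. 4.1.1 proof (d(k)) and Rem. 4.1.4] [cite: PerrinRiou1987BSMF, §1] -/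
theorem d_add_depth_le_succ (hK : IsImaginaryQuadratic K)
    (hstep : ∀ j a : ℕ, 1 ≤ j → ringClassSubgroup K (p ^ j) jbar ≤ κ.layerSubgroup a →
      ringClassSubgroup K (p ^ (j + 1)) jbar ≤ κ.layerSubgroup (a + 1))
    {k : ℕ} (hk : C.depth < k) : C.d k + C.depth ≤ k + 1 := by
  have hp : p.Prime := Fact.out
  -- `Gal(K̄/K[p^j]) ≤ Gal(K̄/K_{δ + j - 1})` for `j ≥ 1`
  have hup : ∀ j, 1 ≤ j → ringClassSubgroup K (p ^ j) jbar ≤ κ.layerSubgroup (C.depth + j - 1) := by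
    intro j hj
    induction j with
    | zero => omega
    | succ j ih =>
      rcases Nat.eq_zero_or_pos j with rfl | hjpos
      · -- `Gal(K̄/K[p]) ≤ Gal(K̄/K[1]) ≤ Gal(K̄/K_δ)`
        have h0 : ringClassSubgroup K (p ^ 0) jbar ≤ κ.layerSubgroup C.depth := by
          have := C.layer_le C.depth
          rwa [(C.d_eq_zero_iff C.depth).mpr le_rfl] at this
        have hanti : ringClassSubgroup K (p ^ 1) jbar ≤ ringClassSubgroup K (p ^ 0) jbar :=
          ringClassSubgroup_anti hK jbar (by simp) (by simp [hp.ne_zero])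
        simpa using hanti.trans h0
      · have h' := hstep j (C.depth + j - 1) hjpos (ih hjpos)
        have heq : C.depth + j - 1 + 1 = C.depth + (j + 1) - 1 := by omega
        rwa [heq] at h'
  have hle : ringClassSubgroup K (p ^ (k + 1 - C.depth)) jbar ≤ κ.layerSubgroup k := by
    have := hup (k + 1 - C.depth) (by omega)
    have heq : C.depth + (k + 1 - C.depth) - 1 = k := by omega
    rwa [heq] at this
  by_contra hlt
  exact C.d_min k (k + 1 - C.depth) (by omega) hle

/-- **The shift is pinned: `d(k) + δ = k + 1` for `k > δ`** (CGLS 2022 Thm. 4.1.1 proof / Rem. 4.1.4: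
`K_∞ ∩ K[p^d] = K_{δ+d−1}` for `d ≥ 1`; `d(k) = k + 1` when `p ∤ h_K`, Howard 2004 §3.3 / Perrin-Riou 1987 §1).
[cite: CastellaGrossiLeeSkinner2022, Thm. 4.1.1 proof (d(k)) and Rem. 4.1.4] [cite: Howard2004HeegnerKolyvagin, §3.3 (K_k ⊂ K[p^{k+1}])] -/
theorem d_add_depth_eq (hK : IsImaginaryQuadratic K)
    (hTw1 : ∀ k, ringClassSubgroup K (p ^ (k + 1)) jbar ≤ κ.layerSubgroup k)
    (hstep : ∀ j a : ℕ, 1 ≤ j → ringClassSubgroup K (p ^ j) jbar ≤ κ.layerSubgroup a →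
      ringClassSubgroup K (p ^ (j + 1)) jbar ≤ κ.layerSubgroup (a + 1))
    (hcardp : Nat.card (ringClassGalOver (jbar.comp (algebraMap K (AlgebraicClosure K))) p 1) = p - 1)
    {k : ℕ} (hk : C.depth < k) : C.d k + C.depth = k + 1 :=
  le_antisymm (C.d_add_depth_le_succ hK hstep hk) (C.succ_le_d_add_depth hK hTw1 hcardp hk)

/-- **The shift climbs by one above the depth: `d(k + 1) = d(k) + 1` for `k > δ`.**
[cite: CastellaGrossiLeeSkinner2022, Thm. 4.1.1 proof (d(k)) and Rem. 4.1.4] -/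
theorem d_succ_eq (hK : IsImaginaryQuadratic K)
    (hTw1 : ∀ k, ringClassSubgroup K (p ^ (k + 1)) jbar ≤ κ.layerSubgroup k)
    (hstep : ∀ j a : ℕ, 1 ≤ j → ringClassSubgroup K (p ^ j) jbar ≤ κ.layerSubgroup a →
      ringClassSubgroup K (p ^ (j + 1)) jbar ≤ κ.layerSubgroup (a + 1))
    (hcardp : Nat.card (ringClassGalOver (jbar.comp (algebraMap K (AlgebraicClosure K))) p 1) = p - 1)
    {k : ℕ} (hk : C.depth < k) : C.d (k + 1) = C.d k + 1 := by
  have h1 := C.d_add_depth_eq hK hTw1 hstep hcardp hk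
  have h2 := C.d_add_depth_eq hK hTw1 hstep hcardp (show C.depth < k + 1 by omega)
  omega

/-- **The first shifted layer has `d(δ + 1) = 2`** (`K_{δ+1} ⊆ K[p²]`, `⊄ K[p]`).
[cite: CastellaGrossiLeeSkinner2022, Thm. 4.1.1 proof (d(k)) and Rem. 4.1.4] -/
theorem d_depth_succ (hK : IsImaginaryQuadratic K)
    (hTw1 : ∀ k, ringClassSubgroup K (p ^ (k + 1)) jbar ≤ κ.layerSubgroup k)
    (hstep : ∀ j a : ℕ, 1 ≤ j → ringClassSubgroup K (p ^ j) jbar ≤ κ.layerSubgroup a →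
      ringClassSubgroup K (p ^ (j + 1)) jbar ≤ κ.layerSubgroup (a + 1))
    (hcardp : Nat.card (ringClassGalOver (jbar.comp (algebraMap K (AlgebraicClosure K))) p 1) = p - 1) :
    C.d (C.depth + 1) = 2 := by
  have h1 := C.d_add_depth_eq hK hTw1 hstep hcardp (show C.depth < C.depth + 1 by omega)
  omega

end CastellaGrossiLeeSkinner2022.StabilizedHeegnerData

end Literature.NumberTheory.EllipticCurves

end
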